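import Mathlib
import Summits.Ventures.PercRepro2.Defs
import Summits.Ventures.PercRepro2.Independence
import Summits.Ventures.PercRepro2.Harris
import Summits.Ventures.PercRepro2.Graph
import Summits.Ventures.PercRepro2.Exploration
import Summits.Ventures.PercRepro2.Events
import Summits.Ventures.PercRepro2.Induced
import Summits.Ventures.PercRepro2.BHK
import Summits.Ventures.PercRepro2.BHKEvents
import Summits.Ventures.PercRepro2.OneEdge
import Summits.Ventures.PercRepro2.RBRoot
import Summits.Ventures.PercRepro2.RBRootEdge
import Summits.Ventures.PercRepro2.RBRootEdgePin
import Summits.Ventures.PercRepro2.RBRootEdgeMain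
import Summits.Ventures.PercRepro2.RBRootIsolated
import Summits.Ventures.PercRepro2.RBTwoMarkers
import Summits.Ventures.PercRepro2.RBTwoMarkersMain
import Summits.Ventures.PercRepro2.RBTwoMarkersCross
import Summits.Ventures.PercRepro2.RBTwoMarkersCrossMain
import Summits.Ventures.PercRepro2.RBLeaf
import Summits.Ventures.PercRepro2.RBSeries
import Summits.Ventures.PercRepro2.RBSeriesMain

/-!
# The series reduction, III: the four-pattern atom masses (mine-a g5; MINE-A.md §36)

`mass_raw` expands `P_p(Q ∩ {C(w) = A} ∩ T)` over the four states of the series pair `(f₁, f₂)`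
through `prob_pattern_atom`; `mass_notMem` / `mass_insert` put the masses of the two `G`-atoms
`A ∌ u` and `insert u A` into the shapes `m` / `m′` of `pair_term`.
-/

namespace Summit.Ventures.PercRepro2

namespace RBSeries

open scoped Classical

section Masses

variable {V : Type*} {E : Type*} [Fintype E] [DecidableEq E] [Fintype V] {R : Type*} [Field R]
  (ends : E → Sym2 V) (s t w u : V)

omit [Fintype V] in
/-- The four-pattern expansion of an atom mass under `p` (raw form). -/
lemma mass_raw (p : E → R) {e₀ f₁ f₂ : E} {v₁ v₂ : V} (hends₀ : ends e₀ = s(v₁, v₂))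
    (hends₁ : ends f₁ = s(u, v₁)) (hends₂ : ends f₂ = s(u, v₂)) (hv₁ : v₁ ≠ u) (hv₂ : v₂ ≠ u)
    (h12 : f₁ ≠ f₂) (h01 : e₀ ≠ f₁) (h02 : e₀ ≠ f₂)
    (hz : ∀ e, u ∈ ends e ∧ e ≠ f₁ ∧ e ≠ f₂ → p e = 0) (hwu : w ≠ u) (hsu : s ≠ u) (htu : t ≠ u)
    (T : Set (Config E))
    (hT : ∀ ω : Config E, (∀ e, u ∈ ends e ∧ e ≠ f₁ ∧ e ≠ f₂ → ω e = false) →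
      (ω ∈ T ↔ eff e₀ f₁ f₂ ω ∈ T)) (A : Set V) :
    prob p ((connEvent ends s t)ᶜ ∩ clusterEvent ends w A ∩ T) =
      p f₁ * p f₂ * (if ((v₁ ∈ A ∨ v₂ ∈ A) ↔ u ∈ A) then
          prob (Function.update (Function.update (Function.update p f₁ 0) f₂ 0) e₀ 1)
            ((connEvent ends s t)ᶜ ∩ clusterEvent ends w (A \ {u}) ∩ T) else 0) +
      p f₁ * (1 - p f₂) * (if (v₁ ∈ A ↔ u ∈ A) then
          p e₀ * prob (Function.update (Function.update (Function.update p f₁ 0) f₂ 0) e₀ 1)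
              ((connEvent ends s t)ᶜ ∩ clusterEvent ends w (A \ {u}) ∩ T) +
            (1 - p e₀) * prob (Function.update (Function.update (Function.update p f₁ 0) f₂ 0) e₀ 0)
              ((connEvent ends s t)ᶜ ∩ clusterEvent ends w (A \ {u}) ∩ T) else 0) +
      (1 - p f₁) * p f₂ * (if (v₂ ∈ A ↔ u ∈ A) then
          p e₀ * prob (Function.update (Function.update (Function.update p f₁ 0) f₂ 0) e₀ 1)
              ((connEvent ends s t)ᶜ ∩ clusterEvent ends w (A \ {u}) ∩ T) +
            (1 - p e₀) * prob (Function.update (Function.update (Function.update p f₁ 0) f₂ 0) e₀ 0)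
              ((connEvent ends s t)ᶜ ∩ clusterEvent ends w (A \ {u}) ∩ T) else 0) +
      (1 - p f₁) * (1 - p f₂) * (if (False ↔ u ∈ A) then
          p e₀ * prob (Function.update (Function.update (Function.update p f₁ 0) f₂ 0) e₀ 1)
              ((connEvent ends s t)ᶜ ∩ clusterEvent ends w (A \ {u}) ∩ T) +
            (1 - p e₀) * prob (Function.update (Function.update (Function.update p f₁ 0) f₂ 0) e₀ 0)
              ((connEvent ends s t)ᶜ ∩ clusterEvent ends w (A \ {u}) ∩ T) else 0) := by
  have I := fun b₁ b₂ => prob_pattern_atom ends s t w u p hends₀ hends₁ hends₂ hv₁ hv₂ h12 h01 h02 hz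
    hwu hsu htu T hT A b₁ b₂
  have I11 := I true true
  have I10 := I true false
  have I01 := I false true
  have I00 := I false false
  clear I
  simp only [Bool.cond_true, Bool.cond_false, Bool.and_true, Bool.and_false, and_true,
    Bool.false_eq_true, and_false, or_false, false_or] at I11 I10 I01 I00
  -- the closed-`e₀` pattern laws are `p[f₁ ↦ 0][f₂ ↦ 0]`, pinned at `e₀`
  have hp00 : Function.update (Function.update (Function.update p f₁ 0) f₂ 0) e₀ (p e₀) =
      Function.update (Function.update p f₁ 0) f₂ 0 :=
    Function.update_eq_self_iff.2 (by rw [Function.update_of_ne h02, Function.update_of_ne h01])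
  have hpin : ∀ S : Set (Config E), prob (Function.update (Function.update p f₁ 0) f₂ 0) S =
      p e₀ * prob (Function.update (Function.update (Function.update p f₁ 0) f₂ 0) e₀ 1) S +
        (1 - p e₀) * prob (Function.update (Function.update (Function.update p f₁ 0) f₂ 0) e₀ 0) S := by
    intro S
    rw [prob_eq_pin (Function.update (Function.update p f₁ 0) f₂ 0) S e₀, Function.update_of_ne h02,
      Function.update_of_ne h01]
  rw [hp00] at I10 I01 I00
  rw [hpin ((connEvent ends s t)ᶜ ∩ clusterEvent ends w (A \ {u}) ∩ T)] at I10 I01 I00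
  rw [prob_eq_pin p _ f₁, prob_eq_pin (Function.update p f₁ 1) _ f₂,
    prob_eq_pin (Function.update p f₁ 0) _ f₂, Function.update_of_ne h12.symm,
    Function.update_of_ne h12.symm, I11, I10, I01, I00]
  ring

omit [Fintype V] in
/-- The atom masses of `A ∌ u` under `p`, in the shape of `pair_term`'s `m`. -/
lemma mass_notMem (p : E → R) {e₀ f₁ f₂ : E} {v₁ v₂ : V} (hends₀ : ends e₀ = s(v₁, v₂))
    (hends₁ : ends f₁ = s(u, v₁)) (hends₂ : ends f₂ = s(u, v₂)) (hv₁ : v₁ ≠ u) (hv₂ : v₂ ≠ u)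
    (h12 : f₁ ≠ f₂) (h01 : e₀ ≠ f₁) (h02 : e₀ ≠ f₂)
    (hz : ∀ e, u ∈ ends e ∧ e ≠ f₁ ∧ e ≠ f₂ → p e = 0) (hwu : w ≠ u) (hsu : s ≠ u) (htu : t ≠ u)
    (T : Set (Config E))
    (hT : ∀ ω : Config E, (∀ e, u ∈ ends e ∧ e ≠ f₁ ∧ e ≠ f₂ → ω e = false) →
      (ω ∈ T ↔ eff e₀ f₁ f₂ ω ∈ T)) {A : Set V} (hu : u ∉ A) :
    prob p ((connEvent ends s t)ᶜ ∩ clusterEvent ends w A ∩ T) =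
      p f₁ * p f₂ * (if ¬ (v₁ ∈ A ∨ v₂ ∈ A) then
          prob (Function.update (Function.update (Function.update p f₁ 0) f₂ 0) e₀ 1)
            ((connEvent ends s t)ᶜ ∩ clusterEvent ends w A ∩ T) else 0) +
      p f₁ * (1 - p f₂) * (if ¬ v₁ ∈ A then
          p e₀ * prob (Function.update (Function.update (Function.update p f₁ 0) f₂ 0) e₀ 1)
              ((connEvent ends s t)ᶜ ∩ clusterEvent ends w A ∩ T) +
            (1 - p e₀) * prob (Function.update (Function.update (Function.update p f₁ 0) f₂ 0) e₀ 0)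
              ((connEvent ends s t)ᶜ ∩ clusterEvent ends w A ∩ T) else 0) +
      (1 - p f₁) * p f₂ * (if ¬ v₂ ∈ A then
          p e₀ * prob (Function.update (Function.update (Function.update p f₁ 0) f₂ 0) e₀ 1)
              ((connEvent ends s t)ᶜ ∩ clusterEvent ends w A ∩ T) +
            (1 - p e₀) * prob (Function.update (Function.update (Function.update p f₁ 0) f₂ 0) e₀ 0)
              ((connEvent ends s t)ᶜ ∩ clusterEvent ends w A ∩ T) else 0) +
      (1 - p f₁) * (1 - p f₂) *
          (p e₀ * prob (Function.update (Function.update (Function.update p f₁ 0) f₂ 0) e₀ 1)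
              ((connEvent ends s t)ᶜ ∩ clusterEvent ends w A ∩ T) +
            (1 - p e₀) * prob (Function.update (Function.update (Function.update p f₁ 0) f₂ 0) e₀ 0)
              ((connEvent ends s t)ᶜ ∩ clusterEvent ends w A ∩ T)) := by
  rw [mass_raw ends s t w u p hends₀ hends₁ hends₂ hv₁ hv₂ h12 h01 h02 hz hwu hsu htu T hT A,
    Set.sdiff_singleton_eq_self hu]
  simp only [eq_false hu, iff_false, iff_self, if_true]

omit [Fintype V] in
/-- The atom masses of `insert u A`, `u ∉ A`, under `p`, in the shape of `pair_term`'s `m′`. -/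
lemma mass_insert (p : E → R) {e₀ f₁ f₂ : E} {v₁ v₂ : V} (hends₀ : ends e₀ = s(v₁, v₂))
    (hends₁ : ends f₁ = s(u, v₁)) (hends₂ : ends f₂ = s(u, v₂)) (hv₁ : v₁ ≠ u) (hv₂ : v₂ ≠ u)
    (h12 : f₁ ≠ f₂) (h01 : e₀ ≠ f₁) (h02 : e₀ ≠ f₂)
    (hz : ∀ e, u ∈ ends e ∧ e ≠ f₁ ∧ e ≠ f₂ → p e = 0) (hwu : w ≠ u) (hsu : s ≠ u) (htu : t ≠ u)
    (T : Set (Config E))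
    (hT : ∀ ω : Config E, (∀ e, u ∈ ends e ∧ e ≠ f₁ ∧ e ≠ f₂ → ω e = false) →
      (ω ∈ T ↔ eff e₀ f₁ f₂ ω ∈ T)) {A : Set V} (hu : u ∉ A) :
    prob p ((connEvent ends s t)ᶜ ∩ clusterEvent ends w (insert u A) ∩ T) =
      p f₁ * p f₂ * (if v₁ ∈ A ∨ v₂ ∈ A then
          prob (Function.update (Function.update (Function.update p f₁ 0) f₂ 0) e₀ 1)
            ((connEvent ends s t)ᶜ ∩ clusterEvent ends w A ∩ T) else 0) +
      p f₁ * (1 - p f₂) * (if v₁ ∈ A then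
          p e₀ * prob (Function.update (Function.update (Function.update p f₁ 0) f₂ 0) e₀ 1)
              ((connEvent ends s t)ᶜ ∩ clusterEvent ends w A ∩ T) +
            (1 - p e₀) * prob (Function.update (Function.update (Function.update p f₁ 0) f₂ 0) e₀ 0)
              ((connEvent ends s t)ᶜ ∩ clusterEvent ends w A ∩ T) else 0) +
      (1 - p f₁) * p f₂ * (if v₂ ∈ A then
          p e₀ * prob (Function.update (Function.update (Function.update p f₁ 0) f₂ 0) e₀ 1)
              ((connEvent ends s t)ᶜ ∩ clusterEvent ends w A ∩ T) +
            (1 - p e₀) * prob (Function.update (Function.update (Function.update p f₁ 0) f₂ 0) e₀ 0)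
              ((connEvent ends s t)ᶜ ∩ clusterEvent ends w A ∩ T) else 0) := by
  rw [mass_raw ends s t w u p hends₀ hends₁ hends₂ hv₁ hv₂ h12 h01 h02 hz hwu hsu htu T hT
    (insert u A), Set.insert_sdiff_self_of_notMem hu]
  have e1 : v₁ ∈ insert u A ↔ v₁ ∈ A := by simp [hv₁]
  have e2 : v₂ ∈ insert u A ↔ v₂ ∈ A := by simp [hv₂]
  simp only [e1, e2, eq_true (Set.mem_insert u A), iff_true, if_false, mul_zero, add_zero]

end Masses

end RBSeries

end Summit.Ventures.PercRepro2
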